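import Literature.AnabelianGeometry.AbsoluteAnabelian.AbsTopIII.Thm19Evaluation
import HarnessLib

/-!
# [AbsTopIII] Thm. 1.9 (e): SATURATED systems of NF-complements and the statement `Thm19eSat`
# (repair of the over-quantified `Thm19e`; statements only)

Mochizuki, *Topics in Absolute Anabelian Geometry III*, §1, Theorem 1.9 (d)(e), manuscript pp. 37–38 (lit
key `paper:url-5493eb38cbb7`): "`V` ranges over the open subschemes obtained by removing finite
collections of NF-points from `Z ×_{k_Z} k′`" (ALL of them); Prop. 1.3 (b) p. 30: "`V_X := {ord_x : K_X^× ↠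
ℤ}_{x ∈ X(k)}` [so we have a natural bijection `V_X ⥲ X(k)`]".

Sub-DAG `plan/L4/SUBDAG-AbsTopIII-Thm19.md`, row Thm19.e.r11 (cell abc-iut; holder and table writer
abc-iut-w5-d213).  SELF-AUDIT FINDING (abc-iut-w5-d213 gen 2, 2026-08-26): the landed statement
`IntrinsicKummerModel.Thm19e` (`Thm19Evaluation.lean`, p416240) quantifies over ALL directed systems
`S : CurveModel.NFComplementSystem` — but the interface's cofinality clauses (`eventually_removed`,
`eventually_small`) only force the levels to become FINE; they do not force every NF-point of `Z` to be
PRESENT at some level.  At the intended model the sub-system of all NF-complements that remove a fixed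
NF-point `P` is a legitimate directed system, and its index set `PointIndex S` (NF-points of the levels
modulo `SamePoint`) misses the place(s) of `P`, so the natural comparison with "`X(k)` = all places of
`K_{Z_NF}/k̄_NF`" is not a bijection: the intended reading of `Thm19e` FAILS for such deficient systems,
and any dictionary hypothesis asserting surjectivity onto the places (`thm19e_of_dictionary`,
`NFDictionary.pointPlace_surjective`) is unsatisfiable for them.  Print's "`V` ranges over" means the FULL
system.  REPAIR (this file): the group-theoretic SATURATION condition `IntrinsicKummerModel.IsSaturated`
("every NF-point of `Z` lies under a rational NF-point of some level" — true for the full system: the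
levels `Z ×_{k_Z} k′` with nothing removed) and the statement `Thm19eSat` = `Thm19e` restricted to
saturated systems (row r11's statement of record from this file on; `Thm19e → Thm19eSat`).  No new Prop
FACT; the new `def … : Prop` restate the printed (e) relative to `M` with the intended quantifier.
HONEST FRAMING: statements-first; typed ≠ proved; nothing here bears on [IUTchIII] Cor. 3.12.
-/

noncomputable section

open CategoryTheory
open scoped Classical Pointwise

namespace Literature.AnabelianGeometry.AbsoluteAnabelian.AbsTopIII

open Literature.NumberTheory.DiophantineGeometry
open Literature.NumberTheory.DiophantineGeometry.AlgFunctionField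

universe u

namespace IntrinsicKummerModel

variable (M : IntrinsicKummerModel.{u}) {Z : M.Curve} {ι : Type u} [Preorder ι]

/-- **Saturated systems** ("`V` ranges over [ALL] the open subschemes obtained by removing finite
collections of NF-points from `Z ×_{k_Z} k′`", Thm. 1.9 (d) p. 37 — the coarse half of "all": nothing is
removed everywhere): every GEOMETRIC NF-point of `Z` lies UNDER a rational NF-point `x` of some level
`V_i`.  Group-theoretically: the decomposition groups in `Π_Z` of the pro-points over a closed point `y`
are the conjugates `g D_y g⁻¹`, and two of them belong to the same point of `Z(k̄)` over `y` iff the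
conjugating elements differ by `Δ_Z` on the left (`Z(k̄) ∋ ỹ ↦ Δ_Z g D_y`, a bijection onto
`Δ_Z \ Π_Z / D_y ≅ G_k / G_{k(y)}`); saturation asks, for EVERY `g`, a level `i` and a rational NF-point
`x` of `V_i` whose decomposition group maps along `Π_{V_i} → Π_Z` into `(δ g) D_y (δ g)⁻¹` for some
`δ ∈ Δ_Z` — i.e. `x` lies over the geometric point of `g`.  (v3.  v1 asked only SOME conjugate — it does
not pin the geometric point; v2 asked the conjugate `g D_y g⁻¹` ITSELF for every `g` — unsatisfiable, the
conjugates being uncountably many and the levels' chosen decomposition groups countably many; the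
`Δ_Z`-saturated form is the property of the full system at the intended model: each of the finitely many
geometric points over `y` is rational over a finite extension `k′ ⊇ k(ỹ)`, and the level `Z ×_{k_Z} k′`
carries it.) [cite: MochizukiAbsTopIII2015, Thm 1.9 (d) p.37] -/
def IsSaturated (S : CurveModel.NFComplementSystem M.toCurveModel Z ι) : Prop :=
  ∀ y : M.Point Z, M.IsNFPoint Z y → ∀ g : (M.ext Z).arith,
    ∃ (i : ι) (x : M.Point (S.V i)) (δ : (M.ext Z).arith), δ ∈ (M.ext Z).geom ∧
      M.IsNFPoint (S.V i) x ∧ M.IsRationalPt (S.V i) x ∧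
        (M.decomp (S.V i) x).map (S.toZ i).arith.toMonoidHom ≤ MulAut.conj (δ * g) • M.decomp Z y

/-- **Thm. 1.9 (e), relative to `M`, for SATURATED systems** ("One constructs the additive structure on
`k̄_NF^× ∪ {0}`; `K_{Z_NF}^× ∪ {0}` [...] by applying the functorial algorithm of Proposition 1.3 to the data
[...] arising from the construction of (d)", p. 38): for every SATURATED directed system of
NF-complements `S` over a (d)-input `Z`, the extracted triple (`evaluationTriple S`) is isomorphic to the
Prop.-1.3 triple of an algebraic function field `K ≅ K_{Z_NF}` of one variable of genus `≥ 2` over an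
algebraically closed `k ≅ k̄_NF`.  NAMED statement relative to `M`; = `Thm19e` with the intended
quantifier (repair of abc-iut self-audit finding: `Thm19e` over-quantifies over deficient systems).
[cite: MochizukiAbsTopIII2015, Thm 1.9 (e) p.38] -/
def Thm19eSat (M : IntrinsicKummerModel.{u}) : Prop :=
  ∀ (Z : M.Curve), M.IsThm19dInput Z → ∀ (ι : Type u) [Preorder ι] [Nonempty ι] [IsDirectedOrder ι]
    (S : CurveModel.NFComplementSystem M.toCurveModel Z ι), M.IsSaturated S →
    ∃ (k : Type u) (K : Type u) (_ : Field k) (_ : Field K) (_ : Algebra k K),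
      IsAlgClosed k ∧ IsAlgFunctionField k K ∧ 2 ≤ genus k K ∧
        Nonempty (K ≃+* M.NFFunctionField Z) ∧ Nonempty (k ≃+* M.kbarNF Z) ∧
          ∃ (φ : (M.evaluationTriple S).G ≃* (valuationEvaluationData k K).G)
            (σ : (M.evaluationTriple S).I ≃ (valuationEvaluationData k K).I),
            (M.evaluationTriple S).IsIso (valuationEvaluationData k K) φ σ

end IntrinsicKummerModel

end Literature.AnabelianGeometry.AbsoluteAnabelian.AbsTopIII
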